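import Summits.BirchSwinnertonDyer.BirchSwinnertonDyer.Theorems.SemiOrdinaryEisensteinDescentWildSigmaDivisibilityAtThreeMultiCarrierOfBeyondMax
import Summits.BirchSwinnertonDyer.BirchSwinnertonDyer.Theorems.SemiOrdinaryEisensteinDescentWildKolyvaginUpperAtThreeTowerFreeBeyondMaxOfPrint
import Summits.BirchSwinnertonDyer.BirchSwinnertonDyer.Theorems.SemiOrdinaryEisensteinDescentWildKolyvaginUpperAtThreeTowerFreeManinPrimitive
import HarnessLib

/-!
# Route `SemiOrdinaryEisensteinDescent` (rev 18), research crux J‴ `WildSigmaDivisibilityAtThreeMultiCarrier` (stmt-BirchSwinnertonDyer-25898)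
# and the banked Ko′ `WildKolyvaginUpperAtThreeTowerFree` (24696): the NORMAL FORM of the Kolyvagin branch —
# print ∧ (depth residue J⁗♭) ∧ («one `3`-good datum per curve»)
# (cell `bsd-wall`, width seat `bsd-wall-soed-p2-w3` gen 2; `--supports stmt-BirchSwinnertonDyer-25898`, helper; BSD is not proved by this file)

Two width seats minimised the two research inputs of the SOED Kolyvagin branch independently on 2026-08-28:
* DEPTHS (this seat, p606966 / p607930 / p608094): the σ-divisibility input is needed only in the half-open depth window
  `max_q ord₃ c_q < s′ ≤ Σ_q ord₃ c_q` on data with `3 ∤ c` — hypothesis J⁗♭ (`hFlatB`), Büyükboduk 2009 §4.2 Question 1 at the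
  additive prime `3` — everything else being Jetchev's max-form (PROVED mod {PT, E0, 3.7 (2)} by w2 g5's p606426);
* MANIN (width seat w2 g5, p606934 / p607248 `…TowerFreeManinPrimitive`): the datum-scaling input `ManinScaling₃` follows from the
  bare arithmetic statement «every curve of the cell that has a parametrisation datum has one with `3 ∤ c`» (`hGood`, the `3`-part
  of Manin's conjecture at `27 ∣ N` in route AdditiveKolyvaginRoad's currency) — the admissible-lattice and degree halves are
  PROVED (`primitiveAdmissible_of_maninGood`, `maninScaling_of_primitiveAdmissible`, `exists_modularDegree_holds`).
This file is their composition: **J‴ BY NAME and Ko′ BY NAME ⟸ the four print primitives + J⁗♭ + hGood.** Nothing else of the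
column is research: after this, a prover of the Kolyvagin branch attacks exactly (Büyükboduk Q1 at `3`, depth form) and
(`3 ∤ c` for one datum), and a vet of 25898 reads the item as that pair modulo print.

HONEST FRAMING. CONDITIONAL theorems: four Literature named facts (CT, 3.7 (2), E0, PT) and two research statements (J⁗♭, hGood)
as displayed hypotheses; no definition, no named fact, no `sorry`; nothing about any curve is asserted; J‴, Ko′, Manin's
conjecture and BSD stay open. BSD is not proved by this file.

References: [Jetchev2008] Thm. 1.4, Conj. 1.3 (p. 812); [Buyukboduk2009TamagawaDefect] §4.2 Question 1; [McCallumLMS1991] §5 Cor.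
5.6 (p. 310); [GrossLMS1991] Prop. 3.7 (2), §6; [EdixhovenManin1991] §1; [CesnaviciusNeururerSaha2023] Thm. 1.2.
-/

set_option autoImplicit false
set_option linter.dupNamespace false -- `Summit.BirchSwinnertonDyer.BirchSwinnertonDyer.…` is the tree's layout (D-0017)

noncomputable section

open scoped Classical

namespace Summit.BirchSwinnertonDyer.BirchSwinnertonDyer.Theorems.WildSigmaDivisibilityAtThreeMultiCarrierOfBeyondMaxOfManinGood

open WeierstrassCurve NumberField Literature.NumberTheory.EllipticCurves
  Literature.NumberTheory.EllipticCurves.ModularForms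
  Literature.NumberTheory.GaloisCohomology
  Summit.BirchSwinnertonDyer.Rank1Residual
  Summit.BirchSwinnertonDyer.Rank1Residual.Additive
  Summit.BirchSwinnertonDyer.Rank1Residual.X11b.Three
  Summit.BirchSwinnertonDyer.BirchSwinnertonDyer.Theses.SemiOrdinaryEisensteinDescent
  Summit.BirchSwinnertonDyer.BirchSwinnertonDyer.Theorems.WildSigmaDivisibilityAtThreeMultiCarrierOfBeyondMax
  Summit.BirchSwinnertonDyer.BirchSwinnertonDyer.Theorems.WildKolyvaginUpperAtThreeTowerFreeBeyondMaxOfPrint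
  Summit.BirchSwinnertonDyer.BirchSwinnertonDyer.Theorems.WildKolyvaginUpperAtThreeTowerFreeManinPrimitive
open Literature.NumberTheory.EllipticCurves.GrossLMS1991 (prop37_2_frobeniusCongruence)

/-- **Crux of record J‴ `WildSigmaDivisibilityAtThreeMultiCarrier` (stmt-25898) BY NAME ⟸ {(PT), (E0), (3.7 (2))} + J⁗♭ (`hFlatB`:
`3^{s′} ∣ P(n)` exactly for `max_q ord₃ c_q < s′ ≤ Σ_q ord₃ c_q`, data with `3 ∤ c`) + hGood («one `3`-good datum per curve of
the cell»).** = p608094 `…_of_flatBeyondMax_of_maninScaling_of_threePrintFacts` with `ManinScaling₃` discharged from `hGood` by w2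
g5's `maninScaling_of_primitiveAdmissible ∘ primitiveAdmissible_of_maninGood` (p606934/p607248). CONDITIONAL on the three named
facts and the two research hypotheses; nothing asserted. [cite: Jetchev2008, Thm. 1.4 and Conj. 1.3 (p. 812)]
[cite: Buyukboduk2009TamagawaDefect, §4.2 Question 1] [cite: EdixhovenManin1991, §1] -/
theorem wildSigmaDivisibilityAtThreeMultiCarrier_of_flatBeyondMax_of_maninGood_of_threePrintFacts
    (hPT : ∀ (K : Type) [Field K] [NumberField K], poitouTate_selmerStructure_duality_conj K)
    (hE0 : Gross1991_heegnerPoint_sub_ratTorsion_mem_E0) (h372 : prop37_2_frobeniusCongruence)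
    (hFlatB : ∀ (W : WeierstrassCurve ℚ) [W.IsElliptic] [W.IsGloballyMinimal] (N : ℕ) [NeZero N] (K : Type)
      [Field K] [NumberField K] (Dt : ModularParametrizationData W N)
      (H : HeegnerDatum N (NumberField.discr K)) (ι : K →+* ℂ) (P : (W.baseChange K).toAffine.Point),
      ClassO6 W 3 → W.HasSurjectiveModNGaloisRep 3 → W.analyticRank = 1 → W.conductorNorm ℤ = N →
      IsImaginaryQuadratic K → SatisfiesHeegnerHypothesis N K →
      (W.quadraticTwist (NumberField.discr K : ℚ)).entireLFunction 1 ≠ 0 →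
      WeierstrassCurve.Affine.Point.map ι.toRatAlgHom P = heegnerPointComplex Dt H →
      ¬ IsOfFinAddOrder P → Odd (NumberField.discr K) → NumberField.discr K ≠ -3 →
      ¬ (3 : ℤ) ∣ Dt.c →
      ∀ (s' : ℕ), (∀ (q : ℕ) [Fact q.Prime], q ∣ N →
        padicValNat 3 ((W.baseChange ℚ_[q]).localTamagawaNumber ℤ_[q]) < s') →
      s' ≤ padicValNat 3 W.tamagawaProduct + padicValNat 3 Dt.c.natAbs →
        ∀ (n : ℕ) (d : KolyvaginHeegnerData Dt H.β ι n), Squarefree n →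
          (∀ ℓ ∈ n.primeFactors, Zhang2014.IsKolyvaginPrime N W K 3 ℓ ∧
            s' ≤ Zhang2014.kolyvaginIndex W 3 ℓ) → Koly.PDiv d 3 s')
    (hGood : ∀ (W : WeierstrassCurve ℚ) [W.IsElliptic] [W.IsGloballyMinimal] (N : ℕ) [NeZero N],
      ClassO6 W 3 → W.HasSurjectiveModNGaloisRep 3 → W.analyticRank = 1 → W.conductorNorm ℤ = N →
      Nonempty (ModularParametrizationData W N) →
      ∃ Dt₀ : ModularParametrizationData W N, ¬ (3 : ℤ) ∣ Dt₀.c) :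
    WildSigmaDivisibilityAtThreeMultiCarrier :=
  wildSigmaDivisibilityAtThreeMultiCarrier_of_flatBeyondMax_of_maninScaling_of_threePrintFacts hPT hE0 h372 hFlatB
    (maninScaling_of_primitiveAdmissible (primitiveAdmissible_of_maninGood hGood))

/-- **Banked Ko′ `WildKolyvaginUpperAtThreeTowerFree` (stmt-24696) BY NAME ⟸ the FOUR PRINT primitives {CT, 3.7 (2), E0, PT} +
J⁗♭ + hGood** — the normal form of the whole Kolyvagin branch: print ∧ (Büyükboduk 2009 §4.2 Q1 at the additive prime `3`, depth
form) ∧ («one `3`-good datum per curve», the `3`-part of Manin's conjecture at `27 ∣ N`). = p607930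
`…BeyondMaxOfPrint.wildKolyvaginUpperAtThreeTowerFree_of_flatBeyondMax_of_maninScaling_of_fourPrimitives` with `ManinScaling₃` from
`hGood` (w2 g5). CONDITIONAL on all six displayed hypotheses; Ko′, J‴, Manin's conjecture and BSD stay open.
[cite: McCallumLMS1991, §5 Cor. 5.6 (p. 310)] [cite: Jetchev2008, Thm. 1.4 and Conj. 1.3 (p. 812)]
[cite: Buyukboduk2009TamagawaDefect, §4.2 Question 1] [cite: CesnaviciusNeururerSaha2023, Thm. 1.2] -/
theorem wildKolyvaginUpperAtThreeTowerFree_of_flatBeyondMax_of_maninGood_of_fourPrimitives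
    (hCT : ∀ (K : Type) [Field K] [NumberField K], casselsTate_levelInputs K)
    (h372 : prop37_2_frobeniusCongruence) (hE0 : Gross1991_heegnerPoint_sub_ratTorsion_mem_E0)
    (hPT : ∀ (K : Type) [Field K] [NumberField K], poitouTate_selmerStructure_duality_conj K)
    (hFlatB : ∀ (W : WeierstrassCurve ℚ) [W.IsElliptic] [W.IsGloballyMinimal] (N : ℕ) [NeZero N] (K : Type)
      [Field K] [NumberField K] (Dt : ModularParametrizationData W N)
      (H : HeegnerDatum N (NumberField.discr K)) (ι : K →+* ℂ) (P : (W.baseChange K).toAffine.Point),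
      ClassO6 W 3 → W.HasSurjectiveModNGaloisRep 3 → W.analyticRank = 1 → W.conductorNorm ℤ = N →
      IsImaginaryQuadratic K → SatisfiesHeegnerHypothesis N K →
      (W.quadraticTwist (NumberField.discr K : ℚ)).entireLFunction 1 ≠ 0 →
      WeierstrassCurve.Affine.Point.map ι.toRatAlgHom P = heegnerPointComplex Dt H →
      ¬ IsOfFinAddOrder P → Odd (NumberField.discr K) → NumberField.discr K ≠ -3 →
      ¬ (3 : ℤ) ∣ Dt.c →
      ∀ (s' : ℕ), (∀ (q : ℕ) [Fact q.Prime], q ∣ N →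
        padicValNat 3 ((W.baseChange ℚ_[q]).localTamagawaNumber ℤ_[q]) < s') →
      s' ≤ padicValNat 3 W.tamagawaProduct + padicValNat 3 Dt.c.natAbs →
        ∀ (n : ℕ) (d : KolyvaginHeegnerData Dt H.β ι n), Squarefree n →
          (∀ ℓ ∈ n.primeFactors, Zhang2014.IsKolyvaginPrime N W K 3 ℓ ∧
            s' ≤ Zhang2014.kolyvaginIndex W 3 ℓ) → Koly.PDiv d 3 s')
    (hGood : ∀ (W : WeierstrassCurve ℚ) [W.IsElliptic] [W.IsGloballyMinimal] (N : ℕ) [NeZero N],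
      ClassO6 W 3 → W.HasSurjectiveModNGaloisRep 3 → W.analyticRank = 1 → W.conductorNorm ℤ = N →
      Nonempty (ModularParametrizationData W N) →
      ∃ Dt₀ : ModularParametrizationData W N, ¬ (3 : ℤ) ∣ Dt₀.c) :
    WildKolyvaginUpperAtThreeTowerFree :=
  wildKolyvaginUpperAtThreeTowerFree_of_flatBeyondMax_of_maninScaling_of_fourPrimitives hCT h372 hE0 hPT hFlatB
    (maninScaling_of_primitiveAdmissible (primitiveAdmissible_of_maninGood hGood))

end Summit.BirchSwinnertonDyer.BirchSwinnertonDyer.Theorems.WildSigmaDivisibilityAtThreeMultiCarrierOfBeyondMaxOfManinGood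

end
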